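import Summits.QuantumFields.BalabanUV.Beta.GAN24.Lin4LegTowerTwo

/-!
# `BalabanUV.Beta.GAN24.LegSlotDivergenceCommute` — row G-an2-4, (Q-L) under the (α-0) parity re-cut (OWNER gan24-p1 g33's RULING R-gan24p1-g33-2
# (3) ∕ (4)-1 «WANTED — the hinge of (3)»): **THE KERNEL-LEG OPERATIONS OF THE (Q-L) LEG TOWER (`rdiv`, `ldiv`, `bsum`, `mreadL`) COMMUTE WITH THE SLOT
# DIVERGENCES (`divW`, `divV`)** — so the leg tower of a slot-divergence-free (or slot-divergence-SLAVED) table stays slot-divergence-free (slaved)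

HONEST DEPENDENCY (page 1, mandatory): continuum YM on T⁴ ⇐ BetaPertH ∧ nine spine estimates (0/9 proved); BetaPertH ⇐ (D1) ∧ (D4) ∧ CAP+tail; G-an2-4
gates asym, D1 and NE2/3/4.  HONEST FRAMING (cell contract, verbatim): «discharging `BetaPertH` makes Bałaban's UV stability UNCONDITIONAL — a real
constructive-QFT result; it is NOT the continuum limit and NOT the Clay problem.»  THIS MODULE DISCHARGES NOTHING of (Q-L) ∕ (H1) ∕ (Q-R) ∕ (LT) ∕ «T2Shape» ∕
(hW, hWall): it is [folklore] finite-sum bookkeeping over this lineage's plumbing `Lin4LegTower.rdiv ∕ bsum ∕ mreadL`, `Lin4LegTowerTwo.ldiv` (g60) and an4's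
`KernelWard.divV ∕ divW` BY NAME — operations on the KERNEL legs of a table commute with operations on its SLOT indices, entry by entry (`Finset.sum_comm`).
0 `def`, 0 `[cite:]`, 0 `def … : Prop`, 0 sorry; no estimate; not in print — our bookkeeping.  NEVER «G-an2-4 closed» as (CONV-C); NOT D1, NOT BetaPertH,
NOT continuum, NOT Clay.
ABSOLUTE RULE (cell charter, verbatim): «No internally-minted statement may enter as a cited fact. Every hypothesis is either kernel-proved in this package
or a verbatim quotation of a PUBLISHED theorem with page reference. The manuscript(s) under audit are NOT citable for their own disputed steps — they are the
thing under adjudication; programme-internal (2001/route/tribunal) claims are never citable.»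

WHY (journal: this seat's W-2 l.49846 (4)-1; the OWNER's RULING R-gan24p1-g33-2 l.49901 (3)–(4)).  Under the parity re-cut the OWNER RULED the (Q-L) display for the
capstone as (H1)^{⊥}: «the k₀-fold leg chain contracts in `sz` on the bounded SLOT-DIVERGENCE-FREE class `{T ∈ bdd₄ ∣ divW T = 0}` — preserved by `vsym ∕ lin4` by
Ward covariance and BY `rdiv` BY (4)-1 — plus the longitudinal (slaved) part carried level by level».  (4)-1 is this file: the leg tower's operations do not see
the slots, so `divW (rdiv ∘ T) = rdiv ∘ (divW T)` etc.; hence `divW T = 0 ⟹ divW (rdiv ∘ T) = 0` and, for a SLAVED table `divW T = L`, `divW (rdiv ∘ T) = rdiv ∘ L`.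
* §1 `rdiv_sub ∕ rdiv_zero ∕ bsum_sub ∕ bsum_zero ∕ mreadL_add ∕ mreadL_sub ∕ mreadL_smul ∕ mreadL_zero ∕ ldiv_add ∕ ldiv_sub ∕ ldiv_smul ∕ ldiv_zero` (linearity not
  already in g60's files) and the pointwise form `divW_apply_gen` ∕ `divV_apply_gen` (generic `d`).
* §2 **`rdiv_divW`** — `rdiv (divW W y ν y′) = divW (fun μ y ν y′ ↦ rdiv (W μ y ν y′)) y ν y′` (the OWNER's (4)-1), `ldiv_divW`, `bsum_divW`, `mreadL_divW`, and the
  first-order twins `rdiv_divV ∕ ldiv_divV ∕ bsum_divV ∕ mreadL_divV` — all UNCONDITIONAL (finite sums of entrywise differences on disjoint index groups).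
* §3 THE CLASS COROLLARIES: `divW_rdiv_eq_zero` ∕ `divW_ldiv_eq_zero` ∕ `divW_bsum_eq_zero` ∕ `divW_mreadL_eq_zero` (slot-divergence-FREE tables stay so under the leg
  operations) and `divW_rdiv_eq_of_slaved` ∕ `divW_bsum_eq_of_slaved` (a slot-divergence SLAVED to `L` stays slaved to the leg image of `L`); `divW_bsum_rdiv_eq_zero`
  (the homogeneous input `𝔹 (rdiv T)` of the g60 window form).
NOT HERE: `vsym ∕ lin4 ∕ legStep` versus `divW` (that is Ward COVARIANCE of the slot read through `K`'s columns — leaf-04 ∕ gan24-p2's laws, not a commutation), any norm,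
(H1) or (H1)^{⊥} themselves.  Provenance: b2b-balaban G-an2-4 crux team (2), leaf prover 03 gen 65, 2026-08-23 (v1); no existing file touched.
-/

noncomputable section

open Finset
open scoped BigOperators
open Literature.MathematicalPhysics.QuantumFieldTheory
open Literature.MathematicalPhysics.QuantumFieldTheory.Balaban1983to89
open Literature.MathematicalPhysics.QuantumFieldTheory.Balaban1983to89.Beta
open B6BondElimination (unitVec)
open ExpKernelCalculus (MKer Site)
open OneStepResolventKernel (Fib)
open KernelWard (divV divW)
open Summit.QuantumFields.BalabanUV.Beta.TameKernelCalculus (trK trK_apply)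
open Summit.QuantumFields.BalabanUV.Beta.GAN24.Lin4LegTower (rdiv bsum mreadL rdiv_apply bsum_apply rdiv_add rdiv_smul bsum_add bsum_smul)
open Summit.QuantumFields.BalabanUV.Beta.GAN24.Lin4LegTowerTwo (ldiv ldiv_apply)

namespace Summit.QuantumFields.BalabanUV.Beta.GAN24.LegSlotDivergenceCommute

variable {d : ℕ}

/-! ## §1 Linearity of the leg plumbing and the pointwise slot divergences -/

/-- [folklore] `rdiv` of the zero kernel. -/
theorem rdiv_zero : rdiv (0 : MKer (d + 1) (Fib d)) = 0 := by
  funext x p a b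
  simp [rdiv_apply]

/-- [folklore] `rdiv` is subtractive. -/
theorem rdiv_sub (F G : MKer (d + 1) (Fib d)) : rdiv (F - G) = rdiv F - rdiv G := by
  rw [sub_eq_add_neg, rdiv_add, ← neg_one_smul ℝ G, rdiv_smul, neg_one_smul, ← sub_eq_add_neg]

/-- [folklore] `bsum` of the zero kernel. -/
theorem bsum_zero (N : ℕ) : bsum N (0 : MKer (d + 1) (Fib d)) = 0 := by
  funext x y a b
  simp [bsum_apply]

/-- [folklore] `bsum` is subtractive. -/
theorem bsum_sub (N : ℕ) (F G : MKer (d + 1) (Fib d)) : bsum N (F - G) = bsum N F - bsum N G := by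
  rw [sub_eq_add_neg, bsum_add, ← neg_one_smul ℝ G, bsum_smul, neg_one_smul, ← sub_eq_add_neg]

/-- [folklore] The entries of `mreadL` on a field row. -/
theorem mreadL_inl (N : ℕ) (F : MKer (d + 1) (Fib d)) (x' y : Site (d + 1)) (α : Fin (d + 1)) (b : Fib d) :
    mreadL N F x' y (Sum.inl α) b = F ((N : ℤ) • x') y (Sum.inr α) b := rfl

/-- [folklore] `mreadL` has no multiplier rows. -/
theorem mreadL_inr (N : ℕ) (F : MKer (d + 1) (Fib d)) (x' y : Site (d + 1)) (ρ : Fin (d + 1)) (b : Fib d) :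
    mreadL N F x' y (Sum.inr ρ) b = 0 := rfl

/-- [folklore] `mreadL` is additive. -/
theorem mreadL_add (N : ℕ) (F G : MKer (d + 1) (Fib d)) : mreadL N (F + G) = mreadL N F + mreadL N G := by
  funext x' y a b
  rcases a with α | ρ
  · simp only [Pi.add_apply, mreadL_inl]
  · simp only [Pi.add_apply, mreadL_inr, add_zero]

/-- [folklore] `mreadL` is homogeneous. -/
theorem mreadL_smul (N : ℕ) (r : ℝ) (F : MKer (d + 1) (Fib d)) : mreadL N (r • F) = r • mreadL N F := by
  funext x' y a b
  rcases a with α | ρ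
  · simp only [Pi.smul_apply, mreadL_inl]
  · simp only [Pi.smul_apply, mreadL_inr, smul_zero]

/-- [folklore] `mreadL` of the zero kernel. -/
theorem mreadL_zero (N : ℕ) : mreadL N (0 : MKer (d + 1) (Fib d)) = 0 := by
  funext x' y a b
  rcases a with α | ρ
  · simp only [mreadL_inl, Pi.zero_apply]
  · simp only [mreadL_inr, Pi.zero_apply]

/-- [folklore] `mreadL` is subtractive. -/
theorem mreadL_sub (N : ℕ) (F G : MKer (d + 1) (Fib d)) : mreadL N (F - G) = mreadL N F - mreadL N G := by
  rw [sub_eq_add_neg, mreadL_add, ← neg_one_smul ℝ G, mreadL_smul, neg_one_smul, ← sub_eq_add_neg]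

/-- [folklore] `ldiv` is additive. -/
theorem ldiv_add (F G : MKer (d + 1) (Fib d)) : ldiv (F + G) = ldiv F + ldiv G := by
  unfold Lin4LegTowerTwo.ldiv
  rw [TameKernelCalculus.trK_add, rdiv_add, TameKernelCalculus.trK_add]

/-- [folklore] `ldiv` is homogeneous. -/
theorem ldiv_smul (r : ℝ) (F : MKer (d + 1) (Fib d)) : ldiv (r • F) = r • ldiv F := by
  funext p z a b
  simp only [ldiv_apply, Pi.smul_apply, smul_eq_mul, Finset.mul_sum]
  exact Finset.sum_congr rfl fun α _ => by ring

/-- [folklore] `ldiv` of the zero kernel. -/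
theorem ldiv_zero : ldiv (0 : MKer (d + 1) (Fib d)) = 0 := by
  funext p z a b
  simp [ldiv_apply]

/-- [folklore] `ldiv` is subtractive. -/
theorem ldiv_sub (F G : MKer (d + 1) (Fib d)) : ldiv (F - G) = ldiv F - ldiv G := by
  rw [sub_eq_add_neg, ldiv_add, ← neg_one_smul ℝ G, ldiv_smul, neg_one_smul, ← sub_eq_add_neg]

/-- [folklore] The entries of the second-order slot divergence (generic `d`): `divW W y ν y′ x z a b = Σ_μ (W μ (y − e_μ) ν y′ x z a b − W μ y ν y′ x z a b)`. -/
theorem divW_apply_gen (W : Fin (d + 1) → (Fin (d + 1) → ℤ) → Fin (d + 1) → (Fin (d + 1) → ℤ) → MKer (d + 1) (Fib d)) (y : Fin (d + 1) → ℤ)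
    (ν : Fin (d + 1)) (y' : Fin (d + 1) → ℤ) (x z : Site (d + 1)) (a b : Fib d) :
    divW W y ν y' x z a b = ∑ μ, (W μ (y - unitVec μ) ν y' x z a b - W μ y ν y' x z a b) := by
  unfold KernelWard.divW
  simp only [Finset.sum_apply, Pi.sub_apply]

/-- [folklore] The entries of the first-order slot divergence (generic `d`). -/
theorem divV_apply_gen (V : Fin (d + 1) → (Fin (d + 1) → ℤ) → MKer (d + 1) (Fib d)) (y : Fin (d + 1) → ℤ) (x z : Site (d + 1)) (a b : Fib d) :
    divV V y x z a b = ∑ μ, (V μ (y - unitVec μ) x z a b - V μ y x z a b) := by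
  unfold KernelWard.divV
  simp only [Finset.sum_apply, Pi.sub_apply]

/-! ## §2 The leg operations commute with the slot divergences -/

section Commute

variable (W : Fin (d + 1) → (Fin (d + 1) → ℤ) → Fin (d + 1) → (Fin (d + 1) → ℤ) → MKer (d + 1) (Fib d))
  (V : Fin (d + 1) → (Fin (d + 1) → ℤ) → MKer (d + 1) (Fib d)) (y : Fin (d + 1) → ℤ) (ν : Fin (d + 1)) (y' : Fin (d + 1) → ℤ)

/-- [folklore] **THE RIGHT-LEG DIVERGENCE COMMUTES WITH THE SLOT DIVERGENCE** (the OWNER's (4)-1 «the hinge of (3)», RULING R-gan24p1-g33-2):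
`rdiv (divW W y ν y′) = divW (fun μ y ν y′ ↦ rdiv (W μ y ν y′)) y ν y′` — unconditional. -/
theorem rdiv_divW : rdiv (divW W y ν y') = divW (fun μ y ν y' => rdiv (W μ y ν y')) y ν y' := by
  funext x p a b
  simp only [rdiv_apply, divW_apply_gen]
  simp only [← Finset.sum_sub_distrib]
  rw [Finset.sum_comm]
  exact Finset.sum_congr rfl fun μ _ => Finset.sum_congr rfl fun β _ => by ring

/-- [folklore] **THE LEFT-LEG DIVERGENCE COMMUTES WITH THE SLOT DIVERGENCE** — unconditional. -/
theorem ldiv_divW : ldiv (divW W y ν y') = divW (fun μ y ν y' => ldiv (W μ y ν y')) y ν y' := by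
  funext p z a b
  simp only [ldiv_apply, divW_apply_gen]
  simp only [← Finset.sum_sub_distrib]
  rw [Finset.sum_comm]
  exact Finset.sum_congr rfl fun μ _ => Finset.sum_congr rfl fun α _ => by ring

/-- [folklore] **THE POSITION BLOCK SUM COMMUTES WITH THE SLOT DIVERGENCE** — unconditional. -/
theorem bsum_divW (N : ℕ) : bsum N (divW W y ν y') = divW (fun μ y ν y' => bsum N (W μ y ν y')) y ν y' := by
  funext x q a b
  simp only [bsum_apply, divW_apply_gen]
  simp only [← Finset.sum_sub_distrib]
  rw [Finset.sum_comm]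

/-- [folklore] **THE LEFT-LEG MULTIPLIER READ COMMUTES WITH THE SLOT DIVERGENCE** — unconditional. -/
theorem mreadL_divW (N : ℕ) : mreadL N (divW W y ν y') = divW (fun μ y ν y' => mreadL N (W μ y ν y')) y ν y' := by
  funext x' z a b
  rcases a with α | ρ
  · simp only [mreadL_inl, divW_apply_gen]
  · simp only [mreadL_inr, divW_apply_gen, sub_self, Finset.sum_const_zero]

/-- [folklore] The right-leg divergence commutes with the first-order slot divergence — unconditional. -/
theorem rdiv_divV : rdiv (divV V y) = divV (fun μ y => rdiv (V μ y)) y := by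
  funext x p a b
  simp only [rdiv_apply, divV_apply_gen]
  simp only [← Finset.sum_sub_distrib]
  rw [Finset.sum_comm]
  exact Finset.sum_congr rfl fun μ _ => Finset.sum_congr rfl fun β _ => by ring

/-- [folklore] The left-leg divergence commutes with the first-order slot divergence — unconditional. -/
theorem ldiv_divV : ldiv (divV V y) = divV (fun μ y => ldiv (V μ y)) y := by
  funext p z a b
  simp only [ldiv_apply, divV_apply_gen]
  simp only [← Finset.sum_sub_distrib]
  rw [Finset.sum_comm]
  exact Finset.sum_congr rfl fun μ _ => Finset.sum_congr rfl fun α _ => by ring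

/-- [folklore] The position block sum commutes with the first-order slot divergence — unconditional. -/
theorem bsum_divV (N : ℕ) : bsum N (divV V y) = divV (fun μ y => bsum N (V μ y)) y := by
  funext x q a b
  simp only [bsum_apply, divV_apply_gen]
  simp only [← Finset.sum_sub_distrib]
  rw [Finset.sum_comm]

/-- [folklore] The left-leg multiplier read commutes with the first-order slot divergence — unconditional. -/
theorem mreadL_divV (N : ℕ) : mreadL N (divV V y) = divV (fun μ y => mreadL N (V μ y)) y := by
  funext x' z a b
  rcases a with α | ρ
  · simp only [mreadL_inl, divV_apply_gen]
  · simp only [mreadL_inr, divV_apply_gen, sub_self, Finset.sum_const_zero]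

end Commute

/-! ## §3 The class corollaries: slot-divergence-free and slot-divergence-slaved tables under the leg operations -/

section Classes

variable {W : Fin (d + 1) → (Fin (d + 1) → ℤ) → Fin (d + 1) → (Fin (d + 1) → ℤ) → MKer (d + 1) (Fib d)}

/-- [folklore] **A SLOT-DIVERGENCE-FREE TABLE HAS A SLOT-DIVERGENCE-FREE RIGHT-DIVERGENCED LEG TABLE** (the class `{T ∣ divW T = 0}` of RULING R-gan24p1-g33-2 (3)
is preserved by `rdiv`). -/
theorem divW_rdiv_eq_zero (h : ∀ y ν y', divW W y ν y' = 0) (y : Fin (d + 1) → ℤ) (ν : Fin (d + 1)) (y' : Fin (d + 1) → ℤ) :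
    divW (fun μ y ν y' => rdiv (W μ y ν y')) y ν y' = 0 := by
  rw [← rdiv_divW, h, rdiv_zero]

/-- [folklore] The same for the left-divergenced leg table. -/
theorem divW_ldiv_eq_zero (h : ∀ y ν y', divW W y ν y' = 0) (y : Fin (d + 1) → ℤ) (ν : Fin (d + 1)) (y' : Fin (d + 1) → ℤ) :
    divW (fun μ y ν y' => ldiv (W μ y ν y')) y ν y' = 0 := by
  rw [← ldiv_divW, h, ldiv_zero]

/-- [folklore] The same for the position block sum. -/
theorem divW_bsum_eq_zero (h : ∀ y ν y', divW W y ν y' = 0) (N : ℕ) (y : Fin (d + 1) → ℤ) (ν : Fin (d + 1)) (y' : Fin (d + 1) → ℤ) :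
    divW (fun μ y ν y' => bsum N (W μ y ν y')) y ν y' = 0 := by
  rw [← bsum_divW, h, bsum_zero]

/-- [folklore] The same for the left-leg multiplier read. -/
theorem divW_mreadL_eq_zero (h : ∀ y ν y', divW W y ν y' = 0) (N : ℕ) (y : Fin (d + 1) → ℤ) (ν : Fin (d + 1)) (y' : Fin (d + 1) → ℤ) :
    divW (fun μ y ν y' => mreadL N (W μ y ν y')) y ν y' = 0 := by
  rw [← mreadL_divW, h, mreadL_zero]

/-- [folklore] **THE HOMOGENEOUS INPUT OF THE g60 WINDOW FORM STAYS SLOT-DIVERGENCE-FREE**: `divW T = 0 ⟹ divW (𝔹 (rdiv T)) = 0` (`bsum ∘ rdiv`, slot by slot). -/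
theorem divW_bsum_rdiv_eq_zero (h : ∀ y ν y', divW W y ν y' = 0) (N : ℕ) (y : Fin (d + 1) → ℤ) (ν : Fin (d + 1)) (y' : Fin (d + 1) → ℤ) :
    divW (fun μ y ν y' => bsum N (rdiv (W μ y ν y'))) y ν y' = 0 := by
  have h1 := divW_rdiv_eq_zero h
  exact divW_bsum_eq_zero (W := fun μ y ν y' => rdiv (W μ y ν y')) h1 N y ν y'

/-- [folklore] **A SLOT-DIVERGENCE SLAVED TO `L` STAYS SLAVED UNDER THE RIGHT-LEG DIVERGENCE**: `divW W = L ⟹ divW (rdiv ∘ W) = rdiv ∘ L` (the longitudinal part of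
RULING R-gan24p1-g33-2 (3) is carried level by level through the leg operation). -/
theorem divW_rdiv_eq_of_slaved {L : (Fin (d + 1) → ℤ) → Fin (d + 1) → (Fin (d + 1) → ℤ) → MKer (d + 1) (Fib d)} (h : ∀ y ν y', divW W y ν y' = L y ν y')
    (y : Fin (d + 1) → ℤ) (ν : Fin (d + 1)) (y' : Fin (d + 1) → ℤ) : divW (fun μ y ν y' => rdiv (W μ y ν y')) y ν y' = rdiv (L y ν y') := by
  rw [← rdiv_divW, h]

/-- [folklore] The same for the left-leg divergence. -/
theorem divW_ldiv_eq_of_slaved {L : (Fin (d + 1) → ℤ) → Fin (d + 1) → (Fin (d + 1) → ℤ) → MKer (d + 1) (Fib d)} (h : ∀ y ν y', divW W y ν y' = L y ν y')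
    (y : Fin (d + 1) → ℤ) (ν : Fin (d + 1)) (y' : Fin (d + 1) → ℤ) : divW (fun μ y ν y' => ldiv (W μ y ν y')) y ν y' = ldiv (L y ν y') := by
  rw [← ldiv_divW, h]

/-- [folklore] The same for the position block sum. -/
theorem divW_bsum_eq_of_slaved {L : (Fin (d + 1) → ℤ) → Fin (d + 1) → (Fin (d + 1) → ℤ) → MKer (d + 1) (Fib d)} (h : ∀ y ν y', divW W y ν y' = L y ν y')
    (N : ℕ) (y : Fin (d + 1) → ℤ) (ν : Fin (d + 1)) (y' : Fin (d + 1) → ℤ) :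
    divW (fun μ y ν y' => bsum N (W μ y ν y')) y ν y' = bsum N (L y ν y') := by
  rw [← bsum_divW, h]

/-- [folklore] The same for the left-leg multiplier read. -/
theorem divW_mreadL_eq_of_slaved {L : (Fin (d + 1) → ℤ) → Fin (d + 1) → (Fin (d + 1) → ℤ) → MKer (d + 1) (Fib d)} (h : ∀ y ν y', divW W y ν y' = L y ν y')
    (N : ℕ) (y : Fin (d + 1) → ℤ) (ν : Fin (d + 1)) (y' : Fin (d + 1) → ℤ) :
    divW (fun μ y ν y' => mreadL N (W μ y ν y')) y ν y' = mreadL N (L y ν y') := by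
  rw [← mreadL_divW, h]

end Classes

end Summit.QuantumFields.BalabanUV.Beta.GAN24.LegSlotDivergenceCommute

end
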